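import Mathlib.Analysis.SpecialFunctions.Log.Deriv
import Mathlib.Analysis.SpecificLimits.Basic
import HarnessLib

/-!
# Kernel-evaluable fixed-point enclosures of logarithms, with soundness

Topic `Literature/Computability/AlgebraicComplexity`; numerical support for the laser-method
certificates of this directory (`RectangularExponentLaserCertificate.lean`: the named fact
`advxxz2025_laserDegeneration` rests on a 24 855-parameter feasible point of the constraint program
of Alman–Duan–Vassilevska Williams–Xu–Xu–Zhou 2025, §7, whose constraints are entropies — sums of
`p log p` — and log-sum-exp penalty bounds; `LaserAlgorithmAssembly.cw5Certificate_of_rates` turns the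
program's limiting condition into the certificate).  Verifying such a point inside Lean needs
CERTIFIED BOUNDS ON LOGARITHMS OF RATIONALS by the ten thousand; this file provides them in the only
form the kernel can run at that scale (the pattern of `BorderRankCWThm42CertKit.lean`: computable
integer code, evaluated by `decide +kernel`, plus soundness theorems): for precision `P` (bits) and
`K` series terms,

* `FixedPoint.logLoCore P K zn zd ≤ 2^P · log((zd+zn)/(zd−zn)) ≤ FixedPoint.logHiCore P K zn zd`
  (`logLoCore_sound`, `logHiCore_sound`; `z = zn/zd ∈ [0, 1/3]`): the series
  `log((1+z)/(1−z)) = 2 Σ_k z^{2k+1}/(2k+1)` (Mathlib `Real.hasSum_log_sub_log_of_abs_lt_one`)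
  evaluated in fixed point with all roundings directed down, resp. up plus the geometric tail bound
  `2 Σ_{k ≥ K} z^{2k+1}/(2k+1) ≤ (9/4) z^{2K+1}/(2K+1)` (`log_le_two_mul_atanhPartial_add`);
* `FixedPoint.logNatLo/HiP K e m` — **`2^P · log m` for a natural `m` with the range hint
  `2^e ≤ m ≤ 2^{e+1}`** (`log m = e log 2 + log(m/2^e)`, both through the core with `z ≤ 1/3`;
  the hint is CHECKED by the decidable `FixedPoint.inRange`, never trusted): `logNatLo_sound`,
  `logNatHi_sound`;
* `FixedPoint.logRatLo/Hi` — **`2^P · log(num/den)` as an integer interval** (`logRat_sound`).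

Accuracy (irrelevant to soundness): with `z ≤ 1/3` the truncation error after `K` terms is
`< 9^{−K}`, and each of the `2K+2` directed roundings costs `< 2^{−P}` relative to the scale, so
`K = 30`, `P = 80` give absolute error `< 2^{−74}` on `log m`; the kernel evaluates 25 000 such
enclosures in about a minute (measured 2026-08-15 on the farm, `Nat.rec` loops, GMP-backed `Nat`).
All code is first-order structural recursion on `ℕ` with `ℕ`/`ℤ` arithmetic only (no `ℚ`, no
well-founded recursion, no `Nat.log`), so that kernel reduction never meets an irreducible.

Everything is proved; no named facts, no axioms beyond the whitelist.

## References

* Standard material: the `atanh` series for the logarithm with directed rounding and a geometric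
  tail bound, e.g. J.-M. Muller, *Elementary Functions* (3rd ed., 2016), §4.2, or R. P. Brent,
  P. Zimmermann, *Modern Computer Arithmetic* (2010), §4.4; here every statement is [folklore] and
  the analytic input is Mathlib's `Real.hasSum_log_sub_log_of_abs_lt_one`.
* J. Alman, R. Duan, V. Vassilevska Williams, Y. Xu, Z. Xu, R. Zhou, *More asymmetry yields faster
  matrix multiplication*, SODA 2025, arXiv:2404.16349, §7 (the numerical program these enclosures
  are for). [AlmanDuanVassilevskaWilliamsXuXuZhou2025]
-/

noncomputable section

open scoped BigOperators
open Finset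

namespace Literature.Computability.AlgebraicComplexity

namespace FixedPoint

/-! ## Directed integer division -/

/-- Ceiling division `⌈a / b⌉` of naturals (`b > 0`; junk `0`-division otherwise). [folklore] -/
def cdiv (a b : ℕ) : ℕ := (a + (b - 1)) / b

/-- `a ≤ ⌈a/b⌉ · b`. [folklore] -/
theorem le_cdiv_mul {a b : ℕ} (hb : 0 < b) : a ≤ cdiv a b * b := by
  unfold cdiv
  have h := Nat.lt_div_mul_add (a := a + (b - 1)) hb
  omega

/-- Ceiling division rounds the real quotient up. [folklore] -/
theorem div_le_cdiv {a b : ℕ} (hb : 0 < b) : (a : ℝ) / b ≤ cdiv a b := by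
  rw [div_le_iff₀ (by exact_mod_cast hb : (0 : ℝ) < b)]
  exact_mod_cast le_cdiv_mul hb (a := a)

/-- Floor division rounds the real quotient down (restated for the casts used here). [folklore] -/
theorem natDiv_le_div (a b : ℕ) : ((a / b : ℕ) : ℝ) ≤ (a : ℝ) / b := Nat.cast_div_le

/-! ## The fixed-point series loop -/

/-- One step of the fixed-point evaluation of `Σ_k z^{2k+1}/(2k+1)` with `z² = zn2/zd2`: the state
`(T, k, A)` (current scaled power `T ≈ C z^{2k+1}`, index, accumulator) goes to
`(T z², k+1, A + T/(2k+1))`, every division rounded down (`up = false`) or up (`up = true`). [folklore] -/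
def atanhStep (up : Bool) (zn2 zd2 : ℕ) (s : ℕ × ℕ × ℕ) : ℕ × ℕ × ℕ :=
  bif up then (cdiv (s.1 * zn2) zd2, s.2.1 + 1, s.2.2 + cdiv s.1 (2 * s.2.1 + 1))
  else (s.1 * zn2 / zd2, s.2.1 + 1, s.2.2 + s.1 / (2 * s.2.1 + 1))

/-- `K` steps of `atanhStep` (structural recursion on `K`). [folklore] -/
def atanhIter (up : Bool) (zn2 zd2 : ℕ) (s : ℕ × ℕ × ℕ) : ℕ → ℕ × ℕ × ℕ
  | 0 => s
  | K + 1 => atanhStep up zn2 zd2 (atanhIter up zn2 zd2 s K)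

/-- Unfolding one step of the loop. [folklore] -/
theorem atanhIter_succ (up : Bool) (zn2 zd2 : ℕ) (s : ℕ × ℕ × ℕ) (K : ℕ) :
    atanhIter up zn2 zd2 s (K + 1) = atanhStep up zn2 zd2 (atanhIter up zn2 zd2 s K) := rfl

/-- The downward step, unfolded. [folklore] -/
theorem atanhStep_false (zn2 zd2 : ℕ) (s : ℕ × ℕ × ℕ) :
    atanhStep false zn2 zd2 s = (s.1 * zn2 / zd2, s.2.1 + 1, s.2.2 + s.1 / (2 * s.2.1 + 1)) := rfl

/-- The upward step, unfolded. [folklore] -/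
theorem atanhStep_true (zn2 zd2 : ℕ) (s : ℕ × ℕ × ℕ) :
    atanhStep true zn2 zd2 s =
      (cdiv (s.1 * zn2) zd2, s.2.1 + 1, s.2.2 + cdiv s.1 (2 * s.2.1 + 1)) := rfl

/-- The real partial sums `S_K(z) = Σ_{k<K} z^{2k+1}/(2k+1)` the loop approximates. [folklore] -/
def atanhPartial (z : ℝ) (K : ℕ) : ℝ := ∑ k ∈ range K, z ^ (2 * k + 1) / (2 * k + 1)

/-- `S_{K+1} = S_K + z^{2K+1}/(2K+1)`. [folklore] -/
theorem atanhPartial_succ (z : ℝ) (K : ℕ) :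
    atanhPartial z (K + 1) = atanhPartial z K + z ^ (2 * K + 1) / (2 * K + 1) := by
  unfold atanhPartial
  rw [sum_range_succ]

/-- `S_K ≥ 0` for `z ≥ 0`. [folklore] -/
theorem atanhPartial_nonneg {z : ℝ} (hz : 0 ≤ z) (K : ℕ) : 0 ≤ atanhPartial z K :=
  sum_nonneg fun k _ => by positivity

/-- **Invariant of the downward loop**: after `K` steps from `(T₀, 0, 0)` with `T₀ ≤ C z`, the index is
`K`, the scaled power is `≤ C z^{2K+1}` and the accumulator is `≤ C · S_K(z)`. [folklore] -/
theorem atanhIter_false_inv {zn2 zd2 : ℕ} {z C : ℝ}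
    (hz2 : (zn2 : ℝ) / zd2 = z ^ 2) {T₀ : ℕ} (hT₀ : (T₀ : ℝ) ≤ C * z) (K : ℕ) :
    (atanhIter false zn2 zd2 (T₀, 0, 0) K).2.1 = K ∧
      ((atanhIter false zn2 zd2 (T₀, 0, 0) K).1 : ℝ) ≤ C * z ^ (2 * K + 1) ∧
      ((atanhIter false zn2 zd2 (T₀, 0, 0) K).2.2 : ℝ) ≤ C * atanhPartial z K := by
  induction K with
  | zero =>
    refine ⟨rfl, ?_, ?_⟩
    · simpa [atanhIter] using hT₀
    · simp [atanhIter, atanhPartial]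
  | succ K ih =>
    obtain ⟨hk, hT, hA⟩ := ih
    rw [atanhIter_succ, atanhStep_false]
    set s := atanhIter false zn2 zd2 (T₀, 0, 0) K with hs
    dsimp only
    refine ⟨by rw [hk], ?_, ?_⟩
    · -- `⌊T zn2 / zd2⌋ ≤ T z² ≤ C z^{2K+1} z²`
      calc ((s.1 * zn2 / zd2 : ℕ) : ℝ) ≤ ((s.1 * zn2 : ℕ) : ℝ) / zd2 := natDiv_le_div _ _
        _ = (s.1 : ℝ) * ((zn2 : ℝ) / zd2) := by push_cast; ring
        _ ≤ C * z ^ (2 * K + 1) * ((zn2 : ℝ) / zd2) := by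
            rw [hz2]; exact mul_le_mul_of_nonneg_right hT (by positivity)
        _ = C * z ^ (2 * (K + 1) + 1) := by rw [hz2]; ring
    · -- `A + ⌊T/(2K+1)⌋ ≤ C S_K + C z^{2K+1}/(2K+1)`
      rw [hk]
      calc ((s.2.2 + s.1 / (2 * K + 1) : ℕ) : ℝ) = (s.2.2 : ℝ) + ((s.1 / (2 * K + 1) : ℕ) : ℝ) := by
            push_cast; ring
        _ ≤ C * atanhPartial z K + (s.1 : ℝ) / (2 * K + 1) := by
            refine add_le_add hA ?_
            have := natDiv_le_div s.1 (2 * K + 1)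
            push_cast at this
            exact this
        _ ≤ C * atanhPartial z K + C * z ^ (2 * K + 1) / (2 * K + 1) := by
            gcongr
        _ = C * atanhPartial z (K + 1) := by rw [atanhPartial_succ]; ring

/-- **Invariant of the upward loop**: after `K` steps from `(T₀, 0, 0)` with `C z ≤ T₀` (`zd2 > 0`), the
index is `K`, the scaled power is `≥ C z^{2K+1}` and the accumulator is `≥ C · S_K(z)`. [folklore] -/
theorem atanhIter_true_inv {zn2 zd2 : ℕ} (hzd : 0 < zd2) {z C : ℝ}
    (hz2 : (zn2 : ℝ) / zd2 = z ^ 2) {T₀ : ℕ} (hT₀ : C * z ≤ T₀) (K : ℕ) :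
    (atanhIter true zn2 zd2 (T₀, 0, 0) K).2.1 = K ∧
      C * z ^ (2 * K + 1) ≤ ((atanhIter true zn2 zd2 (T₀, 0, 0) K).1 : ℝ) ∧
      C * atanhPartial z K ≤ ((atanhIter true zn2 zd2 (T₀, 0, 0) K).2.2 : ℝ) := by
  induction K with
  | zero =>
    refine ⟨rfl, ?_, ?_⟩
    · simpa [atanhIter] using hT₀
    · simp [atanhIter, atanhPartial]
  | succ K ih =>
    obtain ⟨hk, hT, hA⟩ := ih
    rw [atanhIter_succ, atanhStep_true]
    set s := atanhIter true zn2 zd2 (T₀, 0, 0) K with hs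
    dsimp only
    refine ⟨by rw [hk], ?_, ?_⟩
    · calc C * z ^ (2 * (K + 1) + 1) = C * z ^ (2 * K + 1) * ((zn2 : ℝ) / zd2) := by rw [hz2]; ring
        _ ≤ (s.1 : ℝ) * ((zn2 : ℝ) / zd2) := by
            rw [hz2]; exact mul_le_mul_of_nonneg_right hT (by positivity)
        _ = ((s.1 * zn2 : ℕ) : ℝ) / zd2 := by push_cast; ring
        _ ≤ (cdiv (s.1 * zn2) zd2 : ℝ) := div_le_cdiv hzd
    · rw [hk]
      calc C * atanhPartial z (K + 1) = C * atanhPartial z K + C * z ^ (2 * K + 1) / (2 * K + 1) := by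
            rw [atanhPartial_succ]; ring
        _ ≤ (s.2.2 : ℝ) + (s.1 : ℝ) / (2 * K + 1) := by gcongr
        _ ≤ (s.2.2 : ℝ) + (cdiv s.1 (2 * K + 1) : ℝ) := by
            have := div_le_cdiv (a := s.1) (b := 2 * K + 1) (by omega)
            push_cast at this
            linarith
        _ = ((s.2.2 + cdiv s.1 (2 * K + 1) : ℕ) : ℝ) := by push_cast; ring

/-! ## The series bounds for `log((1+z)/(1−z))` -/

/-- **Lower bound by the partial sums**: `2 S_K(z) ≤ log((1+z)/(1−z))` for `0 ≤ z < 1` (all terms of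
the series are non-negative). [folklore] -/
theorem two_mul_atanhPartial_le_log {z : ℝ} (hz0 : 0 ≤ z) (hz1 : z < 1) (K : ℕ) :
    2 * atanhPartial z K ≤ Real.log ((1 + z) / (1 - z)) := by
  have habs : |z| < 1 := by rwa [abs_of_nonneg hz0]
  have h := Real.hasSum_log_sub_log_of_abs_lt_one habs
  rw [Real.log_div (by linarith) (by linarith)]
  have hle := sum_le_hasSum (Finset.range K) (fun k _ => by positivity) h
  calc 2 * atanhPartial z K
        = ∑ k ∈ Finset.range K, (2 : ℝ) * (1 / (2 * k + 1)) * z ^ (2 * k + 1) := by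
          unfold atanhPartial
          rw [Finset.mul_sum]
          refine Finset.sum_congr rfl fun k _ => ?_
          ring
    _ ≤ _ := hle

/-- **Upper bound by the partial sums and the geometric tail**: for `0 ≤ z ≤ 1/3`,
`log((1+z)/(1−z)) ≤ 2 S_K(z) + (9/4) · z^{2K+1}/(2K+1)`
(`2 Σ_{k≥K} z^{2k+1}/(2k+1) ≤ (2/(2K+1)) z^{2K+1} Σ_j z^{2j}` and `Σ_j z^{2j} = 1/(1−z²) ≤ 9/8`). [folklore] -/
theorem log_le_two_mul_atanhPartial_add {z : ℝ} (hz0 : 0 ≤ z) (hz3 : z ≤ 1 / 3) (K : ℕ) :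
    Real.log ((1 + z) / (1 - z)) ≤
      2 * atanhPartial z K + 9 / 4 * (z ^ (2 * K + 1) / (2 * K + 1)) := by
  have hz1 : z < 1 := by linarith
  have habs : |z| < 1 := by rwa [abs_of_nonneg hz0]
  have h : HasSum (fun k : ℕ => (2 : ℝ) * (1 / (2 * k + 1)) * z ^ (2 * k + 1))
      (Real.log (1 + z) - Real.log (1 - z)) :=
    Real.hasSum_log_sub_log_of_abs_lt_one habs
  -- the tail
  have htail := (hasSum_nat_add_iff' K).2 h
  -- the dominating geometric series
  have hq0 : 0 ≤ z ^ 2 := by positivity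
  have hq1 : z ^ 2 < 1 := by nlinarith
  have hCst0 : 0 ≤ 2 / (2 * (K : ℝ) + 1) * z ^ (2 * K + 1) := by positivity
  have hgeom : HasSum (fun k => 2 / (2 * (K : ℝ) + 1) * z ^ (2 * K + 1) * (z ^ 2) ^ k)
      (2 / (2 * (K : ℝ) + 1) * z ^ (2 * K + 1) * (1 - z ^ 2)⁻¹) :=
    (hasSum_geometric_of_lt_one hq0 hq1).mul_left _
  have hdom : ∀ k : ℕ, (2 : ℝ) * (1 / (2 * ((k + K : ℕ) : ℝ) + 1)) * z ^ (2 * (k + K) + 1) ≤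
      2 / (2 * (K : ℝ) + 1) * z ^ (2 * K + 1) * (z ^ 2) ^ k := by
    intro k
    have hden : (2 : ℝ) * (1 / (2 * ((k + K : ℕ) : ℝ) + 1)) ≤ 2 / (2 * K + 1) := by
      rw [mul_one_div]
      apply div_le_div_of_nonneg_left (by norm_num) (by positivity)
      push_cast
      linarith [(Nat.cast_nonneg k : (0 : ℝ) ≤ k)]
    have hpow : z ^ (2 * (k + K) + 1) = z ^ (2 * K + 1) * (z ^ 2) ^ k := by
      rw [← pow_mul, ← pow_add]
      congr 1
      ring
    calc (2 : ℝ) * (1 / (2 * ((k + K : ℕ) : ℝ) + 1)) * z ^ (2 * (k + K) + 1)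
        ≤ 2 / (2 * K + 1) * z ^ (2 * (k + K) + 1) :=
          mul_le_mul_of_nonneg_right hden (by positivity)
      _ = 2 / (2 * (K : ℝ) + 1) * z ^ (2 * K + 1) * (z ^ 2) ^ k := by rw [hpow]; ring
  have hle := hasSum_le hdom htail hgeom
  -- `(1 - z²)⁻¹ ≤ 9/8`
  have hinv : (1 - z ^ 2)⁻¹ ≤ 9 / 8 := by
    rw [inv_le_comm₀ (by nlinarith) (by norm_num)]
    norm_num
    nlinarith
  have hsum : ∑ k ∈ range K, (2 : ℝ) * (1 / (2 * k + 1)) * z ^ (2 * k + 1) =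
      2 * atanhPartial z K := by
    unfold atanhPartial
    rw [Finset.mul_sum]
    refine Finset.sum_congr rfl fun k _ => ?_
    ring
  rw [Real.log_div (by linarith) (by linarith)]
  have hCinv : 2 / (2 * (K : ℝ) + 1) * z ^ (2 * K + 1) * (1 - z ^ 2)⁻¹ ≤
      2 / (2 * (K : ℝ) + 1) * z ^ (2 * K + 1) * (9 / 8) := mul_le_mul_of_nonneg_left hinv hCst0
  have hid : 2 / (2 * (K : ℝ) + 1) * z ^ (2 * K + 1) * (9 / 8) =
      9 / 4 * (z ^ (2 * K + 1) / (2 * K + 1)) := by ring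
  rw [hsum] at hle
  linarith

/-! ## The core enclosure of `2^P · log((zd+zn)/(zd−zn))` -/

/-- **Lower fixed-point value of `2^P log((zd+zn)/(zd−zn))`**: `K` terms of the series at scale
`2^{P+1}`, rounded down. [folklore] -/
def logLoCore (P K zn zd : ℕ) : ℕ :=
  (atanhIter false (zn * zn) (zd * zd) (2 ^ (P + 1) * zn / zd, 0, 0) K).2.2

/-- **Upper fixed-point value of `2^P log((zd+zn)/(zd−zn))`**: `K` terms rounded up plus the tail
bound `⌈9 T_K / (8 (2K+1))⌉`. [folklore] -/
def logHiCore (P K zn zd : ℕ) : ℕ :=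
  (atanhIter true (zn * zn) (zd * zd) (cdiv (2 ^ (P + 1) * zn) zd, 0, 0) K).2.2 +
    cdiv ((atanhIter true (zn * zn) (zd * zd) (cdiv (2 ^ (P + 1) * zn) zd, 0, 0) K).1 * 9)
      (8 * (2 * K + 1))

/-- `(1 + z)/(1 − z) = (zd + zn)/(zd − zn)` for `z = zn/zd`. [folklore] -/
theorem one_add_div_one_sub {zn zd : ℝ} (hzd : zd ≠ 0) (hlt : zn ≠ zd) :
    (1 + zn / zd) / (1 - zn / zd) = (zd + zn) / (zd - zn) := by
  have h2 : zd - zn ≠ 0 := sub_ne_zero.2 (Ne.symm hlt)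
  field_simp

/-- **Soundness of `logLoCore`**: for `zn < zd`,
`logLoCore P K zn zd ≤ 2^P · log((zd+zn)/(zd−zn))`. [folklore] -/
theorem logLoCore_sound (P K : ℕ) {zn zd : ℕ} (hlt : zn < zd) :
    (logLoCore P K zn zd : ℝ) ≤ (2 : ℝ) ^ P * Real.log (((zd : ℝ) + zn) / ((zd : ℝ) - zn)) := by
  have hzd : 0 < zd := by omega
  have hzdR : (0 : ℝ) < zd := by exact_mod_cast hzd
  set z : ℝ := (zn : ℝ) / zd with hz
  have hz0 : 0 ≤ z := by positivity
  have hz1 : z < 1 := by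
    rw [hz, div_lt_one hzdR]; exact_mod_cast hlt
  have hz2 : ((zn * zn : ℕ) : ℝ) / ((zd * zd : ℕ) : ℝ) = z ^ 2 := by
    push_cast; rw [hz]; ring
  have hT₀ : ((2 ^ (P + 1) * zn / zd : ℕ) : ℝ) ≤ (2 : ℝ) ^ (P + 1) * z := by
    refine (natDiv_le_div _ _).trans (le_of_eq ?_)
    push_cast; rw [hz]; ring
  obtain ⟨-, -, hA⟩ := atanhIter_false_inv hz2 hT₀ K
  have hlog := two_mul_atanhPartial_le_log hz0 hz1 K
  have hne : (zn : ℝ) ≠ zd := by exact_mod_cast hlt.ne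
  have hy : (1 + z) / (1 - z) = ((zd : ℝ) + zn) / ((zd : ℝ) - zn) := by
    rw [hz]; exact one_add_div_one_sub hzdR.ne' hne
  rw [hy] at hlog
  calc (logLoCore P K zn zd : ℝ) ≤ (2 : ℝ) ^ (P + 1) * atanhPartial z K := hA
    _ = (2 : ℝ) ^ P * (2 * atanhPartial z K) := by rw [pow_succ]; ring
    _ ≤ (2 : ℝ) ^ P * Real.log (((zd : ℝ) + zn) / ((zd : ℝ) - zn)) :=
        mul_le_mul_of_nonneg_left hlog (by positivity)

/-- **Soundness of `logHiCore`**: for `0 < zd` and `3 zn ≤ zd` (`z ≤ 1/3`),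
`2^P · log((zd+zn)/(zd−zn)) ≤ logHiCore P K zn zd`. [folklore] -/
theorem logHiCore_sound (P K : ℕ) {zn zd : ℕ} (hzd : 0 < zd) (h3 : 3 * zn ≤ zd) :
    (2 : ℝ) ^ P * Real.log (((zd : ℝ) + zn) / ((zd : ℝ) - zn)) ≤ (logHiCore P K zn zd : ℝ) := by
  have hzdR : (0 : ℝ) < zd := by exact_mod_cast hzd
  set z : ℝ := (zn : ℝ) / zd with hz
  have hz0 : 0 ≤ z := by positivity
  have hz3 : z ≤ 1 / 3 := by
    rw [hz, div_le_iff₀ hzdR]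
    have : (3 : ℝ) * zn ≤ zd := by exact_mod_cast h3
    linarith
  have hz1 : z < 1 := by linarith
  have hz2 : ((zn * zn : ℕ) : ℝ) / ((zd * zd : ℕ) : ℝ) = z ^ 2 := by
    push_cast; rw [hz]; ring
  have hT₀ : (2 : ℝ) ^ (P + 1) * z ≤ ((cdiv (2 ^ (P + 1) * zn) zd : ℕ) : ℝ) := by
    refine (le_of_eq ?_).trans (div_le_cdiv hzd)
    push_cast; rw [hz]; ring
  have hzd2 : 0 < zd * zd := Nat.mul_pos hzd hzd
  obtain ⟨-, hT, hA⟩ := atanhIter_true_inv hzd2 hz2 hT₀ K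
  set s := atanhIter true (zn * zn) (zd * zd) (cdiv (2 ^ (P + 1) * zn) zd, 0, 0) K with hs
  have hlog := log_le_two_mul_atanhPartial_add hz0 hz3 K
  have hlt : zn < zd := by omega
  have hne : (zn : ℝ) ≠ zd := by exact_mod_cast hlt.ne
  have hy : (1 + z) / (1 - z) = ((zd : ℝ) + zn) / ((zd : ℝ) - zn) := by
    rw [hz]; exact one_add_div_one_sub hzdR.ne' hne
  rw [hy] at hlog
  -- the tail term
  have htail : (2 : ℝ) ^ (P + 1) * (9 / 8 * (z ^ (2 * K + 1) / (2 * K + 1))) ≤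
      ((cdiv (s.1 * 9) (8 * (2 * K + 1)) : ℕ) : ℝ) := by
    refine le_trans ?_ (div_le_cdiv (by positivity))
    push_cast
    rw [le_div_iff₀ (by positivity)]
    have h9 : (2 : ℝ) ^ (P + 1) * z ^ (2 * K + 1) * 9 ≤ (s.1 : ℝ) * 9 :=
      mul_le_mul_of_nonneg_right hT (by norm_num)
    have : (2 : ℝ) ^ (P + 1) * (9 / 8 * (z ^ (2 * K + 1) / (2 * K + 1))) * (8 * (2 * (K : ℝ) + 1)) =
        (2 : ℝ) ^ (P + 1) * z ^ (2 * K + 1) * 9 := by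
      field_simp
    linarith
  calc (2 : ℝ) ^ P * Real.log (((zd : ℝ) + zn) / ((zd : ℝ) - zn))
        ≤ (2 : ℝ) ^ P * (2 * atanhPartial z K + 9 / 4 * (z ^ (2 * K + 1) / (2 * K + 1))) :=
          mul_le_mul_of_nonneg_left hlog (by positivity)
    _ = (2 : ℝ) ^ (P + 1) * atanhPartial z K +
          (2 : ℝ) ^ (P + 1) * (9 / 8 * (z ^ (2 * K + 1) / (2 * K + 1))) := by rw [pow_succ]; ring
    _ ≤ (s.2.2 : ℝ) + ((cdiv (s.1 * 9) (8 * (2 * K + 1)) : ℕ) : ℝ) := add_le_add hA htail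
    _ = (logHiCore P K zn zd : ℝ) := by rw [logHiCore, ← hs]; push_cast; ring

/-! ## Logarithms of naturals with a checked range hint, and of rationals -/

/-- `2^P log 2`, from below (`2 = (3+1)/(3−1)`, `z = 1/3`). [folklore] -/
def log2Lo (P K : ℕ) : ℕ := logLoCore P K 1 3

/-- `2^P log 2`, from above. [folklore] -/
def log2Hi (P K : ℕ) : ℕ := logHiCore P K 1 3

/-- **`2^P log m` from below**, for `m` with the range hint `2^e ≤ m ≤ 2^{e+1}`:
`e · log 2 + log(m / 2^e)`, the latter through the core with `zn = m − 2^e`, `zd = m + 2^e`. [folklore] -/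
def logNatLo (P K e m : ℕ) : ℕ := e * log2Lo P K + logLoCore P K (m - 2 ^ e) (m + 2 ^ e)

/-- **`2^P log m` from above**, same range hint. [folklore] -/
def logNatHi (P K e m : ℕ) : ℕ := e * log2Hi P K + logHiCore P K (m - 2 ^ e) (m + 2 ^ e)

/-- The range hint `2^e ≤ m ≤ 2^{e+1}` as a Boolean the kernel checks. [folklore] -/
def inRange (e m : ℕ) : Bool := decide (2 ^ e ≤ m) && decide (m ≤ 2 ^ (e + 1))

/-- Reading the range check. [folklore] -/
theorem inRange_iff {e m : ℕ} : inRange e m = true ↔ 2 ^ e ≤ m ∧ m ≤ 2 ^ (e + 1) := by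
  simp [inRange]

/-- `log2Lo ≤ 2^P log 2`. [folklore] -/
theorem log2Lo_sound (P K : ℕ) : (log2Lo P K : ℝ) ≤ (2 : ℝ) ^ P * Real.log 2 := by
  have h := logLoCore_sound P K (zn := 1) (zd := 3) (by norm_num)
  norm_num at h
  exact h

/-- `2^P log 2 ≤ log2Hi`. [folklore] -/
theorem log2Hi_sound (P K : ℕ) : (2 : ℝ) ^ P * Real.log 2 ≤ (log2Hi P K : ℝ) := by
  have h := logHiCore_sound P K (zn := 1) (zd := 3) (by norm_num) (by norm_num)
  norm_num at h
  exact h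

/-- `log m = e log 2 + log((zd+zn)/(zd−zn))` with `zn = m − 2^e`, `zd = m + 2^e` (`2^e ≤ m`). [folklore] -/
theorem log_nat_eq_range {e m : ℕ} (hm : 2 ^ e ≤ m) :
    Real.log m = e * Real.log 2 +
      Real.log ((((m + 2 ^ e : ℕ) : ℝ) + ((m - 2 ^ e : ℕ) : ℝ)) /
        (((m + 2 ^ e : ℕ) : ℝ) - ((m - 2 ^ e : ℕ) : ℝ))) := by
  have h2e : (0 : ℝ) < (2 : ℝ) ^ e := by positivity
  have hm0 : (0 : ℝ) < m := by
    have : 0 < m := lt_of_lt_of_le (Nat.two_pow_pos e) hm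
    exact_mod_cast this
  have hfrac : (((m + 2 ^ e : ℕ) : ℝ) + ((m - 2 ^ e : ℕ) : ℝ)) /
      (((m + 2 ^ e : ℕ) : ℝ) - ((m - 2 ^ e : ℕ) : ℝ)) = (m : ℝ) / (2 : ℝ) ^ e := by
    push_cast [Nat.cast_sub hm]
    have hnum' : ((m : ℝ) + 2 ^ e) + ((m : ℝ) - 2 ^ e) = 2 * m := by ring
    have hden' : ((m : ℝ) + 2 ^ e) - ((m : ℝ) - 2 ^ e) = 2 * 2 ^ e := by ring
    rw [hnum', hden', mul_div_mul_left _ _ (two_ne_zero)]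
  rw [hfrac, Real.log_div hm0.ne' h2e.ne', Real.log_pow]
  ring

/-- **Soundness of `logNatLo`**: `2^e ≤ m ≤ 2^{e+1}` gives `logNatLo P K e m ≤ 2^P log m`. [folklore] -/
theorem logNatLo_sound (P K : ℕ) {e m : ℕ} (hm : 2 ^ e ≤ m) (hm' : m ≤ 2 ^ (e + 1)) :
    (logNatLo P K e m : ℝ) ≤ (2 : ℝ) ^ P * Real.log m := by
  have hcore := logLoCore_sound P K (zn := m - 2 ^ e) (zd := m + 2 ^ e)
    (by have := Nat.two_pow_pos e; omega)
  rw [log_nat_eq_range hm]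
  unfold logNatLo
  push_cast at hcore ⊢
  have h2 := mul_le_mul_of_nonneg_left (log2Lo_sound P K) (Nat.cast_nonneg e)
  have h2P : (0 : ℝ) ≤ (2 : ℝ) ^ P := by positivity
  nlinarith [h2, hcore, h2P]

/-- **Soundness of `logNatHi`**: `2^e ≤ m ≤ 2^{e+1}` gives `2^P log m ≤ logNatHi P K e m`. [folklore] -/
theorem logNatHi_sound (P K : ℕ) {e m : ℕ} (hm : 2 ^ e ≤ m) (hm' : m ≤ 2 ^ (e + 1)) :
    (2 : ℝ) ^ P * Real.log m ≤ (logNatHi P K e m : ℝ) := by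
  have hcore := logHiCore_sound P K (zn := m - 2 ^ e) (zd := m + 2 ^ e)
    (by have := Nat.two_pow_pos e; omega)
    (by rw [pow_succ] at hm'; omega)
  rw [log_nat_eq_range hm]
  unfold logNatHi
  push_cast at hcore ⊢
  have h2 := mul_le_mul_of_nonneg_left (log2Hi_sound P K) (Nat.cast_nonneg e)
  have h2P : (0 : ℝ) ≤ (2 : ℝ) ^ P := by positivity
  nlinarith [h2, hcore, h2P]

/-- **`2^P log(num/den)` from below**: `logNatLo num − logNatHi den` (range hints `en`, `ed`). [folklore] -/
def logRatLo (P K en ed num den : ℕ) : ℤ := (logNatLo P K en num : ℤ) - (logNatHi P K ed den : ℤ)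

/-- **`2^P log(num/den)` from above**: `logNatHi num − logNatLo den`. [folklore] -/
def logRatHi (P K en ed num den : ℕ) : ℤ := (logNatHi P K en num : ℤ) - (logNatLo P K ed den : ℤ)

/-- **Soundness of the rational enclosure**: with both range hints valid (so `num, den ≥ 1`),
`logRatLo ≤ 2^P · log(num/den) ≤ logRatHi`. [folklore] -/
theorem logRat_sound (P K : ℕ) {en ed num den : ℕ} (hn : 2 ^ en ≤ num) (hn' : num ≤ 2 ^ (en + 1))
    (hd : 2 ^ ed ≤ den) (hd' : den ≤ 2 ^ (ed + 1)) :
    ((logRatLo P K en ed num den : ℤ) : ℝ) ≤ (2 : ℝ) ^ P * Real.log ((num : ℝ) / den) ∧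
      (2 : ℝ) ^ P * Real.log ((num : ℝ) / den) ≤ ((logRatHi P K en ed num den : ℤ) : ℝ) := by
  have hnum : (0 : ℝ) < num := by
    have : 0 < num := lt_of_lt_of_le (Nat.two_pow_pos en) hn
    exact_mod_cast this
  have hden : (0 : ℝ) < den := by
    have : 0 < den := lt_of_lt_of_le (Nat.two_pow_pos ed) hd
    exact_mod_cast this
  rw [Real.log_div hnum.ne' hden.ne', mul_sub]
  have h1 := logNatLo_sound P K hn hn'
  have h2 := logNatHi_sound P K hn hn'
  have h3 := logNatLo_sound P K hd hd'
  have h4 := logNatHi_sound P K hd hd'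
  unfold logRatLo logRatHi
  push_cast
  exact ⟨by linarith, by linarith⟩

/-- **The range-checked form** (what a kernel checker uses): if both `inRange` tests pass, the
rational enclosure is sound. [folklore] -/
theorem logRat_sound_of_inRange (P K : ℕ) {en ed num den : ℕ} (hn : inRange en num = true)
    (hd : inRange ed den = true) :
    ((logRatLo P K en ed num den : ℤ) : ℝ) ≤ (2 : ℝ) ^ P * Real.log ((num : ℝ) / den) ∧
      (2 : ℝ) ^ P * Real.log ((num : ℝ) / den) ≤ ((logRatHi P K en ed num den : ℤ) : ℝ) :=
  logRat_sound P K (inRange_iff.1 hn).1 (inRange_iff.1 hn).2 (inRange_iff.1 hd).1 (inRange_iff.1 hd).2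

/-! ## Kernel smoke tests

Tiny sizes (`P = 30`, `K = 12`); the certificates use `P = 80`, `K = 30`.  The kernel computes
`2^30 log 3 ∈ [1179625953, 1179625979]` (true value `1179625962.70…`) and accepts the range hint of `7`. -/

example : logNatLo 30 12 1 3 = 1179625953 ∧ logNatHi 30 12 1 3 = 1179625979 := by decide +kernel

example : inRange 2 7 = true ∧ logRatLo 30 12 2 2 7 5 ≤ logRatHi 30 12 2 2 7 5 := by decide +kernel

end FixedPoint

end Literature.Computability.AlgebraicComplexity

end
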